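import Literature.Combinatorics.Optimization.SDPFormulationMatchingSlack
import Literature.Combinatorics.Optimization.EquivariantPsdFactorization
import Mathlib.LinearAlgebra.Matrix.Permutation
import HarnessLib

/-!
# Coordinate-symmetric SDP formulations of `PM_n` give `S_n`-equivariant psd factorizations

Braun–Brown-Cohen–Huq–Pokutta–Raghavendra–Roy–Weitz–Zink's `G`-coordinate-symmetric SDP formulations
(Definition 2.2: "Action on solutions: `X^{g·s} = g · X^s`", `g` acting on `𝕊^d_+` by permuting coordinates
through `ρ : G → Sym(d)`) [cite: BraunEtAl2016, Def. 2.2 (p. 5)] are the special case of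
Fawzi–Saunderson–Parrilo's `G`-equivariant psd lifts in which every `ρ(g)` is a permutation matrix
("this includes … symmetric lifts where the group acts by permuting coordinates")
[cite: FawziSaundersonParrilo2013, Def. 2 (p. 3) and §1 (p. 4)]; at factorization level an equivariant psd
lift is a psd factorization `S(x, ℓ) = ⟨A(x), B(ℓ)⟩` with `A(g·x) = ρ(g) A(x) ρ(g)ᵀ`
[cite: FawziSaundersonParrilo2013, Thm. 4 (p. 10)], typed for `G = S_n` acting on the perfect matchings of
`K_n` and the odd-cut slacks as `Literature.Combinatorics.Optimization.IsEquivariantPsdFactorization`.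

PROVED here (no named facts), for the perfect matching problem `PM_n = pmProblem n 0` (exact guarantees
`C̃ = S̃ = max`): an `S_n`-coordinate-symmetric SDP formulation `E` of size `d`
(`E.IsCoordSymmetric ρ`, `ρ : S_n →* Sym(Fin d)`) yields an `S_n`-EQUIVARIANT PSD FACTORIZATION OF SIZE `d`
of the odd-cut slack matrix, with matching-side factors the formulation's own `X^M`, representation
`σ ↦ P_{ρ(σ)}` (permutation matrices, `Matrix.permMatrixHom`), and odd-set factors `2 U^{f_{E[U]}}` from
the factorization theorem (`SDPFormulation.exists_hasPsdFactorization_pmOddCutSlack`; the constants `μ_f`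
vanish since `max f_{E[U]}` is attained):

* `SDPFormulation.IsCoordSymmetric.exists_isEquivariantPsdFactorization`,
  `SDPFormulation.IsCoordSymmetric.hasEquivariantPsdFactorization`;
* `le_size_of_equivariantPsdBound` — consequently a lower bound `d ≥ β` valid for all `S_n`-equivariant psd
  factorizations of the odd-cut slack matrix (the shape of the rung statement
  `Summit.PneNP.MatchingPsdRank.MatchingEquivariantPsdBound`) bounds the size of every `S_n`-coordinate-
  symmetric SDP formulation of `PM_n` — the exact (`ε = 0`), full-symmetric-group case of
  [cite: BraunEtAl2016, Thm. 4.10 (p. 9)].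
  -- TODO(general form): Braun et al. allow the alternating group `A_n` and `0 ≤ ε < 1`; the tree's
  -- `IsEquivariantPsdFactorization` is stated for `S_n` and the exact slack.
-/

noncomputable section

open Finset Matrix

namespace Literature.Combinatorics.Optimization

open Literature.Barriers.PneNP

variable {n d : ℕ}

/-- The coordinate action is congruence by a permutation matrix:
`g · X = X_{π⁻¹ ·, π⁻¹ ·} = P_{π⁻¹} X P_{π⁻¹}ᵀ` with `P_τ = τ.permMatrix` (so `σ ↦ P_{ρ(σ)⁻¹}`,
Mathlib's `Matrix.permMatrixHom`, is the homomorphism realising it). [cite: BraunEtAl2016, Def. 2.2 (p. 5)]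
[cite: FawziSaundersonParrilo2013, §1 (p. 4)] -/
theorem permAct_eq_permMatrix_mul_mul_transpose (π : Equiv.Perm (Fin d)) (X : Matrix (Fin d) (Fin d) ℝ) :
    permAct π X = (π⁻¹).permMatrix ℝ * X * ((π⁻¹).permMatrix ℝ)ᵀ := by
  rw [Matrix.transpose_permMatrix, inv_inv, Equiv.Perm.permMatrix, Equiv.Perm.permMatrix,
    PEquiv.toMatrix_toPEquiv_mul, PEquiv.mul_toMatrix_toPEquiv, Matrix.submatrix_submatrix]
  ext i j
  simp [Matrix.submatrix_apply, Equiv.Perm.inv_def]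

/-- **A coordinate-symmetric SDP formulation of `PM_n` is an equivariant psd factorization** (exact case,
size preserved): if `E` is an `S_n`-coordinate-symmetric SDP formulation of `pmProblem n 0` of size `d`
through `ρ : S_n → Sym(d)`, then `(σ ↦ P_{ρ(σ)⁻¹}, M ↦ X^M, U ↦ 2U^{f_{E[U]}})` is an `S_n`-equivariant psd
factorization of size `d` of the odd-cut slack matrix `|δ(U) ∩ M| − 1`.
[cite: BraunEtAl2016, Def. 2.2 (p. 5), Lemma 2.3 (p. 5), §4.5 (p. 9)]
[cite: FawziSaundersonParrilo2013, Def. 2 (p. 3), Thm. 4 (p. 10)] -/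
theorem SDPFormulation.IsCoordSymmetric.exists_isEquivariantPsdFactorization
    {E : SDPFormulation (pmProblem n 0) d} {ρ : Equiv.Perm (Fin n) →* Equiv.Perm (Fin d)}
    (hE : E.IsCoordSymmetric ρ) :
    ∃ (A : Finset (Sym2 (Fin n)) → Matrix (Fin d) (Fin d) ℝ)
      (B : Finset (Fin n) → Matrix (Fin d) (Fin d) ℝ),
      IsEquivariantPsdFactorization n d ((Matrix.permMatrixHom.toHomUnits).comp ρ) A B ∧
      ∀ M : PMSol n, A M.1 = E.X M := by
  classical
  obtain ⟨A₀, hA₀, hslack⟩ := E.exists_hasPsdFactorization_pmOddCutSlack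
  refine ⟨fun M => if h : IsPMOn univ M then E.X ⟨M, h⟩ else 0,
    fun U => if h : Odd U.card then A₀ ⟨U, h⟩ else 0, ⟨?_, ?_, ?_, ?_⟩, fun M => ?_⟩
  · intro M hM
    dsimp only
    rw [dif_pos hM]
    exact E.posSemidef_X _
  · intro U hU
    dsimp only
    rw [dif_pos hU]
    exact hA₀ _
  · intro U M hU hM
    dsimp only
    rw [dif_pos hM, dif_pos hU, Matrix.trace_mul_comm, ← hslack ⟨U, hU⟩ ⟨M, hM⟩, pmOddCutSlack_apply,
      cc_eq_card_filter]
    rfl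
  · intro σ M hM
    have hσM : IsPMOn univ (permEdges σ M) := isPMOn_univ_image_map σ hM
    dsimp only
    rw [dif_pos hσM, dif_pos hM]
    have h1 : E.X ⟨permEdges σ M, hσM⟩ = permAct (ρ σ) (E.X ⟨M, hM⟩) := hE.X_smul σ ⟨M, hM⟩
    rw [h1, MonoidHom.comp_apply, MonoidHom.coe_toHomUnits, Matrix.permMatrixHom_apply]
    exact permAct_eq_permMatrix_mul_mul_transpose (ρ σ) _
  · show (if h : IsPMOn univ M.1 then E.X ⟨M.1, h⟩ else 0) = E.X M
    rw [dif_pos M.2]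

/-- Hence **an `S_n`-coordinate-symmetric SDP formulation of `PM_n` of size `d` witnesses
`HasEquivariantPsdFactorization n d`.** [cite: BraunEtAl2016, Def. 2.2 (p. 5), Lemma 2.3 (p. 5)]
[cite: FawziSaundersonParrilo2013, Def. 2 (p. 3), Thm. 4 (p. 10)] -/
theorem SDPFormulation.IsCoordSymmetric.hasEquivariantPsdFactorization
    {E : SDPFormulation (pmProblem n 0) d} {ρ : Equiv.Perm (Fin n) →* Equiv.Perm (Fin d)}
    (hE : E.IsCoordSymmetric ρ) : HasEquivariantPsdFactorization n d := by
  obtain ⟨A, B, h, -⟩ := hE.exists_isEquivariantPsdFactorization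
  exact ⟨_, A, B, h⟩

/-- **Equivariant psd-rank lower bounds bound symmetric SDP formulations**: if every `S_n`-equivariant psd
factorization of the odd-cut slack matrix of `P_PM(n)` has size `≥ β` (the shape of the rung statement
`MatchingEquivariantPsdBound`, with `β = 2^{αn}`), then every `S_n`-coordinate-symmetric (exact) SDP
formulation of `PM_n` has size `≥ β` — the exact, full-symmetric-group case of Braun et al.'s main theorem.
[cite: BraunEtAl2016, Thm. 4.10 (p. 9)] [cite: FawziSaundersonParrilo2013, Thm. 1 (p. 7)] -/
theorem le_size_of_equivariantPsdBound {β : ℝ}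
    (h : ∀ d : ℕ, HasEquivariantPsdFactorization n d → β ≤ d)
    (E : SDPFormulation (pmProblem n 0) d) (ρ : Equiv.Perm (Fin n) →* Equiv.Perm (Fin d))
    (hE : E.IsCoordSymmetric ρ) : β ≤ d :=
  h d hE.hasEquivariantPsdFactorization

/-- Contrapositive: **no `S_n`-equivariant psd factorization of size `d` ⇒ no `S_n`-coordinate-symmetric
SDP formulation of `PM_n` of size `d`.** [cite: BraunEtAl2016, Thm. 4.10 (p. 9)]
[cite: FawziSaundersonParrilo2013, Thm. 4 (p. 10)] -/
theorem SDPFormulation.not_isCoordSymmetric_of_not_hasEquivariantPsdFactorization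
    (h : ¬HasEquivariantPsdFactorization n d) (E : SDPFormulation (pmProblem n 0) d)
    (ρ : Equiv.Perm (Fin n) →* Equiv.Perm (Fin d)) : ¬E.IsCoordSymmetric ρ :=
  fun hE => h hE.hasEquivariantPsdFactorization

end Literature.Combinatorics.Optimization
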